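import Mathlib
import Literature.Computability.AlgebraicComplexity.PrattTrapezoidVal

/-!
# Beating `|G|` needs a common difference — a micro-barrier for Pratt's `Val(G)`

For finite sets `A, B, C` in an abelian group `G` write `T(A,B,C) = #{(a,b,c) ∈ A × B × C : a+b+c = 0}`
(`zeroSumTriples`) and `P(A,B,C) = (A − A) ∩ (B − B) ∩ (C − C)` (the *common differences*; it
contains `0` as soon as the three sets are nonempty).  The main inequality of this file is

`T(A,B,C) ≤ |G| · #P(A,B,C)`                                    (`soloVal_card_zeroSumTriples_le`)

Proof: pair every zero-sum triple `(a,b,c)` with every `c' ∈ C` and map `((a,b,c),c') ↦ (a+c', c)`;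
two pairs in one fibre differ by `d = a₁ − a₀ = b₀ − b₁ = c'₀ − c'₁ ∈ P`, and `d` determines the pair,
so every fibre has at most `#P` elements while the image has at most `|G|·#C` elements.

Consequences.
* `soloVal_card_zeroSumTriples_le_card`: if `A − A`, `B − B`, `C − C` have only `0` in common then
  `T(A,B,C) ≤ |G|` — although this *difference condition* implies equilateral-trapezoid-freeness
  (`soloVal_etf_of_commonDiff_subset`), it can never produce `Val(G) > |G|`: subgroup / coset-tiling /
  "three planes in `𝔽_p³`" configurations are capped at `|G|` (they attain it).
* `soloVal_exists_commonDiff_of_card_lt`: any triple with more than `|G|` zero-sum triples — in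
  particular every witness of `Val(G) > |G|`, e.g. in `ℤ/140` (`SoloBlindPrattValCyclic`) — contains a
  nonzero common difference `d ∈ (A−A) ∩ (B−B) ∩ (C−C)`; quantitatively a witness of
  `Val(G) ≥ |G|^{1+c}` needs at least `|G|^{c}` common differences.

This is consequence-side bookkeeping for Pratt's `Val` hierarchy [Pratt2024, Def. 3.2, Conj. 4.1];
it has no bearing on `ω`.
-/

set_option linter.dupNamespace false

namespace Summit.MatrixMultiplication.MatrixMultiplication.Theorems

open Finset Literature.Computability.AlgebraicComplexity
open scoped Pointwise

variable {G : Type*} [AddCommGroup G] [DecidableEq G]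

omit [DecidableEq G] in
/-- In a zero-sum triple the middle entry is determined: `b = -(a) - c` phrased as
`a + b = -c`. [folklore] -/
theorem soloVal_zeroSum_fst_add (t : G × G × G) (h : t.1 + t.2.1 + t.2.2 = 0) :
    t.1 + t.2.1 = -t.2.2 :=
  eq_neg_of_add_eq_zero_left h

/-- **Main inequality.**  `T(A,B,C) ≤ |G| · #((A−A) ∩ (B−B) ∩ (C−C))` for all finite
`A, B, C` in a finite abelian group. [new, elementary] -/
theorem soloVal_card_zeroSumTriples_le [Fintype G] (A B C : Finset G) :
    #(zeroSumTriples A B C) ≤ Fintype.card G * #((A - A) ∩ (B - B) ∩ (C - C)) := by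
  classical
  set P := (A - A) ∩ (B - B) ∩ (C - C) with hP
  set Z := zeroSumTriples A B C with hZ
  -- W = Z × C, f ((a,b,c), c') = (a + c', c)
  set W := Z ×ˢ C with hW
  set f : (G × G × G) × G → G × G := fun w => (w.1.1 + w.2, w.1.2.2) with hf
  have hfibre : ∀ q ∈ W.image f, #(W.filter fun w => f w = q) ≤ #P := by
    intro q hq
    obtain ⟨w₀, hw₀, rfl⟩ := mem_image.mp hq
    have hw₀Z : w₀.1 ∈ Z := (mem_product.mp hw₀).1
    have hw₀C : w₀.2 ∈ C := (mem_product.mp hw₀).2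
    obtain ⟨⟨ha₀, hb₀, hc₀⟩, hs₀⟩ := mem_zeroSumTriples.mp hw₀Z
    -- injection: w ↦ w.1.1 - w₀.1.1 into P
    refine card_le_card_of_injOn (fun w => w.1.1 - w₀.1.1) ?_ ?_
    · intro w hw
      simp only [coe_filter, Set.mem_setOf_eq] at hw
      obtain ⟨hwW, hfw⟩ := hw
      have hwZ : w.1 ∈ Z := (mem_product.mp hwW).1
      have hwC : w.2 ∈ C := (mem_product.mp hwW).2
      obtain ⟨⟨ha, hb, hc⟩, hs⟩ := mem_zeroSumTriples.mp hwZ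
      have hfw' : (w.1.1 + w.2, w.1.2.2) = (w₀.1.1 + w₀.2, w₀.1.2.2) := by
        simpa only [hf] using hfw
      obtain ⟨h1, h2⟩ := Prod.mk.inj hfw'
      simp only [hP, mem_coe, mem_inter]
      refine ⟨⟨sub_mem_sub ha ha₀, ?_⟩, ?_⟩
      · -- b₀ - b = a - a₀
        have e : w₀.1.2.1 - w.1.2.1 = w.1.1 - w₀.1.1 := by
          have u := soloVal_zeroSum_fst_add _ hs
          have u₀ := soloVal_zeroSum_fst_add _ hs₀
          rw [h2] at u
          rw [sub_eq_sub_iff_add_eq_add, add_comm, u, ← u₀, add_comm]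
        rw [← e]; exact sub_mem_sub hb₀ hb
      · -- c'₀ - c' = a - a₀
        have e : w₀.2 - w.2 = w.1.1 - w₀.1.1 := by
          rw [sub_eq_sub_iff_add_eq_add, add_comm, ← h1, add_comm]
        rw [← e]; exact sub_mem_sub hw₀C hwC
    · intro w hw w' hw' heq
      simp only [coe_filter, Set.mem_setOf_eq] at hw hw'
      have ha : w.1.1 = w'.1.1 := sub_left_injective heq
      have hfw : (w.1.1 + w.2, w.1.2.2) = (w₀.1.1 + w₀.2, w₀.1.2.2) := by
        simpa only [hf] using hw.2
      have hfw' : (w'.1.1 + w'.2, w'.1.2.2) = (w₀.1.1 + w₀.2, w₀.1.2.2) := by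
        simpa only [hf] using hw'.2
      obtain ⟨h1, h2⟩ := Prod.mk.inj hfw
      obtain ⟨h1', h2'⟩ := Prod.mk.inj hfw'
      have hc' : w.2 = w'.2 := by
        have := h1.trans h1'.symm
        rw [ha] at this
        exact add_left_cancel this
      have hs := (mem_zeroSumTriples.mp (mem_product.mp hw.1).1).2
      have hs' := (mem_zeroSumTriples.mp (mem_product.mp hw'.1).1).2
      have hb : w.1.2.1 = w'.1.2.1 := by
        have u := soloVal_zeroSum_fst_add _ hs
        have u' := soloVal_zeroSum_fst_add _ hs'
        rw [h2] at u; rw [h2'] at u'; rw [← u', ha] at u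
        exact add_left_cancel u
      have hcc : w.1.2.2 = w'.1.2.2 := h2.trans h2'.symm
      exact Prod.ext (Prod.ext ha (Prod.ext hb hcc)) hc'
  have hWle : #W ≤ #P * #(W.image f) := card_le_mul_card_image W #P hfibre
  have himg : #(W.image f) ≤ Fintype.card G * #C := by
    have hsub : W.image f ⊆ (univ : Finset G) ×ˢ C := by
      intro q hq
      obtain ⟨w, hw, rfl⟩ := mem_image.mp hq
      have hwZ : w.1 ∈ Z := (mem_product.mp hw).1
      obtain ⟨⟨_, _, hc⟩, _⟩ := mem_zeroSumTriples.mp hwZ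
      exact mem_product.mpr ⟨mem_univ _, hc⟩
    calc #(W.image f) ≤ #((univ : Finset G) ×ˢ C) := card_le_card hsub
      _ = Fintype.card G * #C := by rw [card_product, card_univ]
  have hWeq : #W = #Z * #C := card_product Z C
  by_cases hC : #C = 0
  · -- C = ∅ ⇒ Z = ∅
    have hCe : C = ∅ := card_eq_zero.mp hC
    have hZe : #Z = 0 := by
      rw [hZ, hCe]; simp [zeroSumTriples]
    rw [hZe]; exact Nat.zero_le _
  · have hpos : 0 < #C := Nat.pos_of_ne_zero hC
    have : #Z * #C ≤ (Fintype.card G * #P) * #C := by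
      calc #Z * #C = #W := hWeq.symm
        _ ≤ #P * #(W.image f) := hWle
        _ ≤ #P * (Fintype.card G * #C) := Nat.mul_le_mul_left _ himg
        _ = (Fintype.card G * #P) * #C := by ring
    exact Nat.le_of_mul_le_mul_right this hpos

/-- **Micro-barrier.**  If the three difference sets have only `0` in common then
`T(A,B,C) ≤ |G|`. [new, elementary] -/
theorem soloVal_card_zeroSumTriples_le_card [Fintype G] (A B C : Finset G)
    (h : (A - A) ∩ (B - B) ∩ (C - C) ⊆ {0}) :
    #(zeroSumTriples A B C) ≤ Fintype.card G := by
  have h1 : #((A - A) ∩ (B - B) ∩ (C - C)) ≤ 1 := by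
    simpa using card_le_card h
  calc #(zeroSumTriples A B C) ≤ Fintype.card G * #((A - A) ∩ (B - B) ∩ (C - C)) :=
        soloVal_card_zeroSumTriples_le A B C
    _ ≤ Fintype.card G * 1 := Nat.mul_le_mul_left _ h1
    _ = Fintype.card G := mul_one _

/-- **Beating `|G|` needs a prism.**  More than `|G|` zero-sum triples force a nonzero common
difference `d ∈ (A−A) ∩ (B−B) ∩ (C−C)`. [new, elementary] -/
theorem soloVal_exists_commonDiff_of_card_lt [Fintype G] (A B C : Finset G)
    (h : Fintype.card G < #(zeroSumTriples A B C)) :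
    ∃ d : G, d ≠ 0 ∧ d ∈ A - A ∧ d ∈ B - B ∧ d ∈ C - C := by
  by_contra hne
  have hsub : (A - A) ∩ (B - B) ∩ (C - C) ⊆ {0} := by
    intro d hd
    simp only [mem_inter] at hd
    rw [mem_singleton]
    by_contra hd0
    exact hne ⟨d, hd0, hd.1.1, hd.1.2, hd.2⟩
  exact absurd (soloVal_card_zeroSumTriples_le_card A B C hsub) (not_le.mpr h)

/-- **Quantitative form.**  A triple with at least `M · |G|` zero-sum triples (`M ≥ 1`) has at least
`M` common differences (counting `0`). [new, elementary] -/
theorem soloVal_le_card_commonDiff [Fintype G] (A B C : Finset G) (M : ℕ)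
    (h : M * Fintype.card G < #(zeroSumTriples A B C) + Fintype.card G) :
    M ≤ #((A - A) ∩ (B - B) ∩ (C - C)) := by
  have hG : 0 < Fintype.card G := Fintype.card_pos
  have := soloVal_card_zeroSumTriples_le A B C
  by_contra hlt
  -- #P ≤ M - 1
  have hP : #((A - A) ∩ (B - B) ∩ (C - C)) + 1 ≤ M := not_le.mp hlt
  have : #(zeroSumTriples A B C) + Fintype.card G ≤ M * Fintype.card G := by
    calc #(zeroSumTriples A B C) + Fintype.card G
        ≤ Fintype.card G * #((A - A) ∩ (B - B) ∩ (C - C)) + Fintype.card G := by omega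
      _ = (#((A - A) ∩ (B - B) ∩ (C - C)) + 1) * Fintype.card G := by ring
      _ ≤ M * Fintype.card G := Nat.mul_le_mul_right _ hP
  omega

/-- The difference condition is a genuine *sufficient* condition for Pratt's Definition 3.2:
`(A−A) ∩ (B−B) ∩ (C−C) ⊆ {0}` implies equilateral-trapezoid-freeness (two solutions of any of the
three systems differ by a nonzero common difference). [new, elementary] -/
theorem soloVal_etf_of_commonDiff_subset (A B C : Finset G)
    (h : (A - A) ∩ (B - B) ∩ (C - C) ⊆ {0}) :
    IsEquilateralTrapezoidFree A B C := by
  have key : ∀ d : G, d ∈ A - A → d ∈ B - B → d ∈ C - C → d = 0 := by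
    intro d h1 h2 h3
    have : d ∈ (A - A) ∩ (B - B) ∩ (C - C) := by simp only [mem_inter]; exact ⟨⟨h1, h2⟩, h3⟩
    exact mem_singleton.mp (h this)
  refine ⟨?_, ?_, ?_⟩
  · -- a', b' fixed: solutions (a,b,c) with a'+b+c = 0, a+b'+c = 0
    intro a' ha' b' hb'
    refine card_le_one.mpr ?_
    intro t ht t' ht'
    simp only [mem_filter, mem_product] at ht ht'
    obtain ⟨⟨hta, htb, htc⟩, e1, e2⟩ := ht
    obtain ⟨⟨hta', htb', htc'⟩, e1', e2'⟩ := ht'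
    -- d = c - c'
    have dB : t'.2.1 - t.2.1 = t.2.2 - t'.2.2 := by
      rw [sub_eq_sub_iff_add_eq_add]
      have u : a' + (t.2.1 + t.2.2) = a' + (t'.2.1 + t'.2.2) := by
        rw [← add_assoc, ← add_assoc, e1, e1']
      have := add_left_cancel u
      rw [add_comm] at this; rw [this, add_comm]
    have dA : t'.1 - t.1 = t.2.2 - t'.2.2 := by
      rw [sub_eq_sub_iff_add_eq_add]
      have u : t.1 + t.2.2 + b' = t'.1 + t'.2.2 + b' := by
        have v : t.1 + b' + t.2.2 = t'.1 + b' + t'.2.2 := by rw [e2, e2']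
        calc t.1 + t.2.2 + b' = t.1 + b' + t.2.2 := by abel
          _ = t'.1 + b' + t'.2.2 := v
          _ = t'.1 + t'.2.2 + b' := by abel
      have := add_right_cancel u
      rw [add_comm] at this; rw [← this, add_comm]
    have hd : t.2.2 - t'.2.2 = 0 :=
      key _ (dA ▸ sub_mem_sub hta' hta) (dB ▸ sub_mem_sub htb' htb) (sub_mem_sub htc htc')
    have hc : t.2.2 = t'.2.2 := sub_eq_zero.mp hd
    have hb : t.2.1 = t'.2.1 := by
      have := dB; rw [hd] at this; exact (sub_eq_zero.mp this).symm
    have ha : t.1 = t'.1 := by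
      have := dA; rw [hd] at this; exact (sub_eq_zero.mp this).symm
    exact Prod.ext ha (Prod.ext hb hc)
  · -- a', c' fixed: a'+b+c = 0, a+b+c' = 0, indexed by b
    intro a' ha' c' hc'
    refine card_le_one.mpr ?_
    intro t ht t' ht'
    simp only [mem_filter, mem_product] at ht ht'
    obtain ⟨⟨hta, htb, htc⟩, e1, e2⟩ := ht
    obtain ⟨⟨hta', htb', htc'⟩, e1', e2'⟩ := ht'
    -- d = b - b'
    have dC : t'.2.2 - t.2.2 = t.2.1 - t'.2.1 := by
      rw [sub_eq_sub_iff_add_eq_add]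
      have u : a' + (t.2.2 + t.2.1) = a' + (t'.2.2 + t'.2.1) := by
        calc a' + (t.2.2 + t.2.1) = a' + t.2.1 + t.2.2 := by abel
          _ = 0 := e1
          _ = a' + t'.2.1 + t'.2.2 := e1'.symm
          _ = a' + (t'.2.2 + t'.2.1) := by abel
      have := add_left_cancel u
      rw [add_comm] at this; rw [this, add_comm]
    have dA : t'.1 - t.1 = t.2.1 - t'.2.1 := by
      rw [sub_eq_sub_iff_add_eq_add]
      have u : t.1 + t.2.1 + c' = t'.1 + t'.2.1 + c' := by rw [e2, e2']
      have := add_right_cancel u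
      rw [add_comm] at this; rw [← this, add_comm]
    have hd : t.2.1 - t'.2.1 = 0 :=
      key _ (dA ▸ sub_mem_sub hta' hta) (sub_mem_sub htb htb') (dC ▸ sub_mem_sub htc' htc)
    have hb : t.2.1 = t'.2.1 := sub_eq_zero.mp hd
    have hc : t.2.2 = t'.2.2 := by
      have := dC; rw [hd] at this; exact (sub_eq_zero.mp this).symm
    have ha : t.1 = t'.1 := by
      have := dA; rw [hd] at this; exact (sub_eq_zero.mp this).symm
    exact Prod.ext ha (Prod.ext hb hc)
  · -- b', c' fixed: a+b'+c = 0, a+b+c' = 0, indexed by a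
    intro b' hb' c' hc'
    refine card_le_one.mpr ?_
    intro t ht t' ht'
    simp only [mem_filter, mem_product] at ht ht'
    obtain ⟨⟨hta, htb, htc⟩, e1, e2⟩ := ht
    obtain ⟨⟨hta', htb', htc'⟩, e1', e2'⟩ := ht'
    -- d = a - a'
    have dC : t'.2.2 - t.2.2 = t.1 - t'.1 := by
      rw [sub_eq_sub_iff_add_eq_add]
      have u : b' + (t.2.2 + t.1) = b' + (t'.2.2 + t'.1) := by
        calc b' + (t.2.2 + t.1) = t.1 + b' + t.2.2 := by abel
          _ = 0 := e1
          _ = t'.1 + b' + t'.2.2 := e1'.symm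
          _ = b' + (t'.2.2 + t'.1) := by abel
      have := add_left_cancel u
      rw [add_comm] at this; rw [this, add_comm]
    have dB : t'.2.1 - t.2.1 = t.1 - t'.1 := by
      rw [sub_eq_sub_iff_add_eq_add]
      have u : c' + (t.2.1 + t.1) = c' + (t'.2.1 + t'.1) := by
        calc c' + (t.2.1 + t.1) = t.1 + t.2.1 + c' := by abel
          _ = 0 := e2
          _ = t'.1 + t'.2.1 + c' := e2'.symm
          _ = c' + (t'.2.1 + t'.1) := by abel
      have := add_left_cancel u
      rw [add_comm] at this; rw [this, add_comm]
    have hd : t.1 - t'.1 = 0 :=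
      key _ (sub_mem_sub hta hta') (dB ▸ sub_mem_sub htb' htb) (dC ▸ sub_mem_sub htc' htc)
    have ha : t.1 = t'.1 := sub_eq_zero.mp hd
    have hb : t.2.1 = t'.2.1 := by
      have := dB; rw [hd] at this; exact (sub_eq_zero.mp this).symm
    have hc : t.2.2 = t'.2.2 := by
      have := dC; rw [hd] at this; exact (sub_eq_zero.mp this).symm
    exact Prod.ext ha (Prod.ext hb hc)

/-- Every extremal triple for `Val(G)` with `Val(G) > |G|` contains a nonzero common difference —
e.g. in `ℤ/140ℤ`, where `Val ≥ 144` (`SoloBlindPrattValCyclic`). [new, elementary] -/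
theorem soloVal_prattVal_witness_has_commonDiff [Fintype G] (hG : Fintype.card G < prattVal G) :
    ∃ A B C : Finset G, IsEquilateralTrapezoidFree A B C ∧ #(zeroSumTriples A B C) = prattVal G ∧
      ∃ d : G, d ≠ 0 ∧ d ∈ A - A ∧ d ∈ B - B ∧ d ∈ C - C := by
  obtain ⟨A, B, C, hE, hT⟩ := exists_prattVal_eq (G := G)
  exact ⟨A, B, C, hE, hT, soloVal_exists_commonDiff_of_card_lt A B C (hT ▸ hG)⟩

end Summit.MatrixMultiplication.MatrixMultiplication.Theorems
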